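import Summits.MatrixMultiplication.MatrixMultiplication.Theses.LevelGradedCohnUmans

/-!
# The garbage wall: targets are free, so the test space pays for the garbage it sees
# (crux `LevelGradedCohnUmans.GradedDesignFamily`, stmt-MatrixMultiplication-7610; negative side, lead c4)

Let `J ≤ ℂ^G` be ANY subspace (no invariance) and `(X, Y, Z)` `J`-separated in the sense of the route
(for every target `(x₀, z₀) ∈ X × Z` some `f ∈ J` reads `f(x⁻¹ y y'⁻¹ z) = [x = x₀ ∧ y = y' ∧ z = z₀]`
on `X × Y × Y × Z`), `Y ≠ ∅`.  Call `P := X⁻¹ Y Y⁻¹ Z` the footprint, `T := X⁻¹ Z ⊆ P` the targets and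
`P ∖ T` the GARBAGE.  For every set `S` of garbage words,

* `card_mul_card_add_finrank_restrict_le` —  `|X|·|Z| + dim (J|_S) ≤ dim J`,

where `J|_S` is the space of restrictions to `S` of functions in `J` (`J.map (funLeft (↑))`).

So the wall `|X||Z| ≤ dim J` of the tree is paid IN ADDITION to everything the test space can still
distinguish on the garbage: a separated design with `|X||Z| ≥ c·dim J` needs garbage of `J`-rank
`≤ (1 − c)·dim J`, however large the garbage set is.  Every catalogued count of this crux is this
inequality plus a lower bound for `dim J|_S` on a garbage family `S` known to be `J`-independent
(`S = x₁⁻¹ y₁ (Y∖y₁)⁻¹ Z` gives the `t = 1` family Neumann count `|Z|(|X|+|Y|−1) ≤ dim J` when `J` is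
left-invariant; `S = (X∖x₁)⁻¹ Y y₁⁻¹ z₁` its mirror), and a KILL of a saturation stub (`|X||Z| ≥ c dim J`
along a family) is exactly a garbage-rank lower bound `dim J|_S ≥ (1 − c + δ) dim J`.

PROOF.  Evaluation at the `|X||Z|` target words, `Φ₁ f := (f(x₀⁻¹ y₁ y₁⁻¹ z₀))_{(x₀,z₀)}`, maps `J`
ONTO `ℂ^{X×Z}` (the separator of `(x₀, z₀)` goes to the coordinate vector), so
`dim J = |X||Z| + dim ker Φ₁`; and restriction to `S`, `Φ₂`, kills every separator (a garbage word is
a footprint word whose pattern value is `0`, since value `1` would make it the target word), hence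
`Φ₂ f = Φ₂ (f − Σ_r Φ₁(f)_r · f_r)` with `f − Σ_r Φ₁(f)_r f_r ∈ ker Φ₁`: `J|_S = Φ₂(ker Φ₁)` has
dimension `≤ dim ker Φ₁`.

Sorry-free; axioms `propext`, `Classical.choice`, `Quot.sound`.
-/

set_option linter.dupNamespace false

noncomputable section

open scoped BigOperators
open Module

namespace Summit.MatrixMultiplication.MatrixMultiplication.Theorems.GradedDesignFamily.Negative

/-- The separation clause of the route in `if … then 1 else 0` form (single triple). -/
theorem sep_ite_single {G : Type} [Group G] [DecidableEq G] {J : Submodule ℂ (G → ℂ)}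
    {X Y Z : Finset G}
    (hsep : ∀ x₀ ∈ X, ∀ z₀ ∈ Z, ∃ f ∈ J, ∀ x ∈ X, ∀ y ∈ Y, ∀ y' ∈ Y, ∀ z ∈ Z,
      (x = x₀ ∧ y = y' ∧ z = z₀ → f (x⁻¹ * y * y'⁻¹ * z) = 1) ∧
      (¬ (x = x₀ ∧ y = y' ∧ z = z₀) → f (x⁻¹ * y * y'⁻¹ * z) = 0))
    {x₀ : G} (hx₀ : x₀ ∈ X) {z₀ : G} (hz₀ : z₀ ∈ Z) :
    ∃ f : J, ∀ x ∈ X, ∀ y ∈ Y, ∀ y' ∈ Y, ∀ z ∈ Z,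
      (f : G → ℂ) (x⁻¹ * y * y'⁻¹ * z) = if (x = x₀ ∧ y = y' ∧ z = z₀) then 1 else 0 := by
  obtain ⟨f, hf, hspec⟩ := hsep x₀ hx₀ z₀ hz₀
  refine ⟨⟨f, hf⟩, fun x hx y hy y' hy' z hz => ?_⟩
  obtain ⟨h1, h0⟩ := hspec x hx y hy y' hy' z hz
  split_ifs with hc
  · exact h1 hc
  · exact h0 hc

/-- **The garbage wall.**  If `(X, Y, Z)` is `J`-separated (route clause, any subspace `J ≤ ℂ^G`) with
`Y ≠ ∅`, and `S` is a set of GARBAGE words (footprint words `x⁻¹ y y'⁻¹ z` that are not target words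
`x⁻¹ z`), then `|X|·|Z| + dim J|_S ≤ dim J`. -/
theorem card_mul_card_add_finrank_restrict_le {G : Type} [Group G] [Fintype G] [DecidableEq G]
    (J : Submodule ℂ (G → ℂ)) (X Y Z : Finset G) (hY : Y.Nonempty)
    (hsep : ∀ x₀ ∈ X, ∀ z₀ ∈ Z, ∃ f ∈ J, ∀ x ∈ X, ∀ y ∈ Y, ∀ y' ∈ Y, ∀ z ∈ Z,
      (x = x₀ ∧ y = y' ∧ z = z₀ → f (x⁻¹ * y * y'⁻¹ * z) = 1) ∧
      (¬ (x = x₀ ∧ y = y' ∧ z = z₀) → f (x⁻¹ * y * y'⁻¹ * z) = 0))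
    (S : Finset G)
    (hSP : ∀ s ∈ S, ∃ x ∈ X, ∃ y ∈ Y, ∃ y' ∈ Y, ∃ z ∈ Z, s = x⁻¹ * y * y'⁻¹ * z)
    (hST : ∀ s ∈ S, ∀ x ∈ X, ∀ z ∈ Z, s ≠ x⁻¹ * z) :
    X.card * Z.card + Module.finrank ℂ (J.map (LinearMap.funLeft ℂ ℂ ((↑) : ↥S → G))) ≤
      Module.finrank ℂ J := by
  classical
  obtain ⟨y₁, hy₁⟩ := hY
  -- separators, one per target
  let R : Type := ↥(X ×ˢ Z)
  have memR : ∀ r : R, r.1.1 ∈ X ∧ r.1.2 ∈ Z := fun r => Finset.mem_product.1 r.2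
  have hrow : ∀ r : R, ∃ f : J, ∀ x ∈ X, ∀ y ∈ Y, ∀ y' ∈ Y, ∀ z ∈ Z,
      (f : G → ℂ) (x⁻¹ * y * y'⁻¹ * z) = if (x = r.1.1 ∧ y = y' ∧ z = r.1.2) then 1 else 0 :=
    fun r => sep_ite_single hsep (memR r).1 (memR r).2
  choose f hf using hrow
  -- Φ₁ : evaluation at the target words (through `y₁ y₁⁻¹`)
  let Φ₁ : J →ₗ[ℂ] (R → ℂ) := LinearMap.pi fun r : R =>
    (LinearMap.proj (r.1.1⁻¹ * y₁ * y₁⁻¹ * r.1.2) : (G → ℂ) →ₗ[ℂ] ℂ).comp J.subtype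
  have hΦ₁ : ∀ (φ : J) (r : R), Φ₁ φ r = (φ : G → ℂ) (r.1.1⁻¹ * y₁ * y₁⁻¹ * r.1.2) :=
    fun φ r => rfl
  have hΦ₁f : ∀ r₀ r : R, Φ₁ (f r₀) r = if r = r₀ then 1 else 0 := by
    intro r₀ r
    rw [hΦ₁, hf r₀ _ (memR r).1 y₁ hy₁ y₁ hy₁ _ (memR r).2]
    by_cases hrr : r = r₀
    · subst hrr; simp
    · rw [if_neg hrr, if_neg]
      rintro ⟨hx, -, hz⟩
      apply hrr
      obtain ⟨⟨x, z⟩, hr⟩ := r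
      obtain ⟨⟨x₀, z₀⟩, hr₀⟩ := r₀
      simp only at hx hz
      subst hx; subst hz
      rfl
  have hsurj : Function.Surjective Φ₁ := by
    intro w
    refine ⟨∑ r, w r • f r, ?_⟩
    rw [map_sum]
    funext r₀
    simp only [map_smul, Finset.sum_apply, Pi.smul_apply, hΦ₁f, smul_eq_mul, mul_ite, mul_one,
      mul_zero]
    rw [Finset.sum_ite_eq]
    simp
  -- Φ₂ : restriction to the garbage set `S`; it kills every separator
  let Φ₂ : J →ₗ[ℂ] (↥S → ℂ) := (LinearMap.funLeft ℂ ℂ ((↑) : ↥S → G)).comp J.subtype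
  have hΦ₂ : ∀ (φ : J) (s : ↥S), Φ₂ φ s = (φ : G → ℂ) s := fun φ s => rfl
  have hΦ₂f : ∀ r : R, Φ₂ (f r) = 0 := by
    intro r
    funext s
    obtain ⟨x, hx, y, hy, y', hy', z, hz, hs⟩ := hSP s s.2
    rw [hΦ₂, Pi.zero_apply, hs, hf r x hx y hy y' hy' z hz, if_neg]
    rintro ⟨-, hyy, -⟩
    exact hST s s.2 x hx z hz (by rw [hs, hyy, mul_inv_cancel_right])
  -- range Φ₂ = Φ₂ (ker Φ₁)
  have hrange : LinearMap.range Φ₂ ≤ LinearMap.range (Φ₂.comp (LinearMap.ker Φ₁).subtype) := by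
    rintro _ ⟨φ, rfl⟩
    have hker : φ - ∑ r, Φ₁ φ r • f r ∈ LinearMap.ker Φ₁ := by
      rw [LinearMap.mem_ker, map_sub, map_sum, sub_eq_zero]
      funext r₀
      simp only [map_smul, Finset.sum_apply, Pi.smul_apply, hΦ₁f, smul_eq_mul, mul_ite, mul_one,
        mul_zero]
      rw [Finset.sum_ite_eq]
      simp
    refine ⟨⟨_, hker⟩, ?_⟩
    rw [LinearMap.comp_apply, Submodule.subtype_apply, map_sub, map_sum]
    simp only [map_smul, hΦ₂f, smul_zero, Finset.sum_const_zero, sub_zero]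
  -- bookkeeping
  have hmap : J.map (LinearMap.funLeft ℂ ℂ ((↑) : ↥S → G)) = LinearMap.range Φ₂ := by
    rw [LinearMap.range_comp, Submodule.range_subtype]
  have h1 : finrank ℂ (LinearMap.range Φ₂) ≤ finrank ℂ (LinearMap.ker Φ₁) :=
    (Submodule.finrank_mono hrange).trans (LinearMap.finrank_range_le _)
  have hrn := LinearMap.finrank_range_add_finrank_ker Φ₁
  rw [LinearMap.range_eq_top.mpr hsurj, finrank_top, Module.finrank_fintype_fun_eq_card] at hrn
  have hR : Fintype.card R = X.card * Z.card := by
    rw [Fintype.card_coe, Finset.card_product]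
  rw [hmap, ← hrn, ← hR]
  omega

end Summit.MatrixMultiplication.MatrixMultiplication.Theorems.GradedDesignFamily.Negative

end
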